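import Summits.ResolutionOfSingularities.ResolutionOfSingularities.Theorems.WeightedInvariantIota3SteepLocal
import Summits.ResolutionOfSingularities.ResolutionOfSingularities.Theorems.WeightedInvariantSuccessorRatioBoundStability
import HarnessLib

/-!
# (SUCC-RATIO) with the SHARP margin `1 + ρ/q` ⟸ (NONREACH-K): at the pinned successor the successor ratio bound follows from the non-reach of
# the single slope `(q+ρ)/q` along the translates `W − c·t⁻¹` (door `HypersurfaceCentreConstruction`, stmt-ResolutionOfSingularities-19897)

Helper for `stub_keyRungGrHomLE_three` (def-free, `--supports 19897`).  Position-level assembly of this hand's pinning theorem (`Iota3.steep_pinning`,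
…Iota3SteepPinningW) with res-L1-w43-idea-2's R9 reductions (…SuccessorRatioBoundStability: `ratContactFiltration_mono_ratio`,
`ratContactFiltration_unit_mul`, `ratContactFiltration_congr_mod_pow`, `nonmem_of_representatives`).

* **`Iota3.successorRatioBound_of_nonreachK`** — `L` regular local of dimension three, `𝔪 = (T, z, W)`, `g = c W^ν + T H` (`c` a unit, `ν ≥ 1`),
  `0 < ρ ≤ q`: if `g ∉ ratContactFiltration (W − c'·T) (q+ρ) q ((q+ρ)ν)` for EVERY `c' ∈ L`, then
  `SuccessorRatioBound L g ν q ρ` — every admissible two-flag reach `(q'; r₁, r₂)` of `g` has `r₁·q < (q+ρ)·r₂`.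
  (Flat reaches: `ρ > 0`.  Steep reaches: the first member is `W`-led with `z`-coefficient in `𝔪` (`steep_pinning`); rational contact is antitone in
  the ratio, so the reach descends to the ratio `(q+ρ)/q ≤ 2`; there `𝔪²`-perturbations and unit factors of the flag member are invisible
  (`nonmem_of_representatives` with `Λ = L`), so the member may be taken to be `W − c'·T`.)
* **`Iota3.successorRatioBound_mono_rho`** — the bound is monotone in the margin `ρ`.

So the curve regime's (SUCC-RATIO) (margin `r − q`, …Iota3CurveSigmaRatioBounds) follows from (NONREACH-K) with `ρ = r mod q` (`0 < r mod q < q`,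
`r mod q ≤ r − q`): **the saturated transform must not reach the slope `1 + (r mod q)/q` along any translate `W − c'·t⁻¹`** — res-L1-w43-idea-2's
(b′) in its final form («the witness lands low», R9 §5 `witness_lands_low`).  The binder-level gap list is the sequel file.

[OURS · L1 W4.3 · kernel lemma; AI work, weaker than expert review; nothing here is a statement of the manuscript under review
(Hironaka 2017, [claim: Hironaka2017, status: under-review]).]

## References

* H. Hironaka, *Characteristic polyhedra of singularities*, J. Math. Kyoto Univ. 7 (1967), §3. [Hironaka1967]
* res-L1-w43-idea-2, Sketch-R9 §5, §11, §12 (OURS; tree …SuccessorRatioBoundContact / …Stability).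
-/

noncomputable section

set_option linter.dupNamespace false -- mandated namespace of this single-conjunct summit

open IsLocalRing Literature.AlgebraicGeometry.Resolution
open Summit.ResolutionOfSingularities.ResolutionOfSingularities.Theorems
open Summit.ResolutionOfSingularities.ResolutionOfSingularities.Cruxes.HypersurfaceCentreConstruction.LocalEngine.Iota3.RatContact

namespace Summit.ResolutionOfSingularities.ResolutionOfSingularities.Cruxes.HypersurfaceCentreConstruction.LocalEngine

namespace Iota3

/-- **The successor ratio bound is monotone in the margin**: `SuccessorRatioBound L g ν q ρ → SuccessorRatioBound L g ν q ρ'` for `ρ ≤ ρ'`.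
[folklore] -/
theorem successorRatioBound_mono_rho {L : Type} [CommRing L] [IsLocalRing L] {g : L} {ν q ρ ρ' : ℕ} (hρ : ρ ≤ ρ')
    (h : SuccessorRatioBound L g ν q ρ) : SuccessorRatioBound L g ν q ρ' := fun q' r₁ r₂ hadm hfl =>
  lt_of_lt_of_le (h q' r₁ r₂ hadm hfl) (Nat.mul_le_mul_right _ (by omega))

/-- **(SUCC-RATIO) with margin `ρ` ⟸ (NONREACH-K)**: `L` regular local of dimension three, `𝔪 = (T, z, W)`, `g = c W^ν + T H` with `c` a unit,
`ν ≥ 1`, `0 < ρ ≤ q`; if `g ∉ ratContactFiltration (W − c'·T) (q+ρ) q ((q+ρ)ν)` for every `c' ∈ L`, then every admissible two-flag reach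
`(q'; r₁, r₂)` of `g` has `r₁·q < (q+ρ)·r₂`. [OURS · L1 W4.3 · R9 (b′) assembled] [cite: Hironaka1967, §3] -/
theorem successorRatioBound_of_nonreachK {L : Type} [CommRing L] [IsRegularLocalRing L] (hdim : ringKrullDim L = (3 : ℕ)) {T z W c H : L}
    (hspan : Ideal.span {T, z, W} = maximalIdeal L) (hc : IsUnit c) {ν q ρ : ℕ} (hν : 1 ≤ ν) (hq : 0 < q) (hρ : 0 < ρ) (hρq : ρ ≤ q)
    (hK : ∀ c' : L, c * W ^ ν + T * H ∉ ratContactFiltration (W - c' * T) (q + ρ) q ((q + ρ) * ν)) :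
    SuccessorRatioBound L (c * W ^ ν + T * H) ν q ρ := by
  have hTm : T ∈ maximalIdeal L := hspan ▸ Ideal.subset_span (by simp)
  have hzm : z ∈ maximalIdeal L := hspan ▸ Ideal.subset_span (by simp)
  -- non-reach at every ratio in `[K, 2]` along every translate `W − c'·T` (antitone in the ratio)
  have hWlin : ∀ c' ∈ (Set.univ : Set L), ∀ A B : ℕ, 0 < B → (q + ρ) * B ≤ A * q → A ≤ 2 * B →
      c * W ^ ν + T * H ∉ ratContactFiltration (W - c' * T) A B (A * ν) := by
    intro c' _ A B hB hAB _ hmem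
    exact hK c' (ratContactFiltration_mono_ratio hB hq hAB ν hmem)
  -- hence along every competitor `α T + β z + γ W` with `γ` a unit and `β ∈ 𝔪`, at ratios in `[K, 2]`
  have hcomp := nonmem_of_representatives (Set.univ : Set L) (fun x => ⟨x, Set.mem_univ x, by rw [sub_self]; exact Ideal.zero_mem _⟩)
    hTm hzm (ν := ν) (q := q) (ρ := ρ) hWlin
  intro q' r₁ r₂ hadm hfl
  obtain ⟨-, hr₂, hr₁⟩ := hadm.pos
  by_contra hlt
  have hle : (q + ρ) * r₂ ≤ r₁ * q := Nat.le_of_not_lt hlt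
  obtain ⟨g₁, hg₁, -, hmem⟩ := FlagReaches.oneFlagReaches hadm hfl
  rcases Nat.lt_or_ge r₂ r₁ with hsteep | hflat
  · -- steep: the member is `W`-led with `z`-coefficient in `𝔪`; descend to the ratio `(q+ρ)/q ≤ 2`
    rw [← hspan] at hg₁
    obtain ⟨α, β, γ, hg₁eq⟩ := exists_eq_combination_of_mem_span_triple hg₁
    rw [hg₁eq] at hmem
    obtain ⟨hβ, hγ⟩ := steep_pinning hdim hspan hc hν hr₂ hsteep hmem
    have hmemK : c * W ^ ν + T * H ∈ ratContactFiltration (α * T + β * z + γ * W) (q + ρ) q ((q + ρ) * ν) :=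
      ratContactFiltration_mono_ratio hr₂ hq hle ν hmem
    exact hcomp α β γ hγ hβ (q + ρ) q hq le_rfl (by omega) hmemK
  · -- flat: `r₁ = r₂`, and `ρ > 0`
    have heq : r₁ = r₂ := le_antisymm hflat hadm.2.2
    subst heq
    have h1 : (q + ρ) * r₁ ≤ q * r₁ := by rw [mul_comm r₁ q] at hle; exact hle
    have h2 : q * r₁ < (q + ρ) * r₁ := Nat.mul_lt_mul_of_pos_right (by omega) hr₁
    exact absurd h1 (not_le.mpr h2)

end Iota3

end Summit.ResolutionOfSingularities.ResolutionOfSingularities.Cruxes.HypersurfaceCentreConstruction.LocalEngine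

end
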